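import Summits.RiemannHypothesis.RiemannHypothesis.Theorems.WeilGroundStateGroundStatesConvergeToXiRenormOverlapLimit
import Literature.NumberTheory.LFunctions.WeilGroundStateRealZerosProofs
import HarnessLib

/-!
# `WeilGroundState.GroundStatesConvergeToXi` — minimal renormalisation is `L²`-convergence
(crux item stmt-RiemannHypothesis-1527, route route-RiemannHypothesis-WeilGroundState; line `Sketch`,
lead c5; `--supports`)

RH-free.  For a witness `(a_k, u_k, c_k)` of the crux's convergence clause (`u_k` ground states at
`a_k → ∞`, `c_k · weilMellin u_k → ξ` locally uniformly on the open strip) the renormalisation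
constants satisfy `liminf ‖c_k‖ ≥ ‖Φ‖₂` (`…RenormLowerBound`).  Here we identify the extremal
case: **the constants are asymptotically minimal, `‖c_k‖ → ‖Φ‖₂`, if and only if the
renormalised ground states converge to Riemann's kernel in `L²(ℝ)`, `∫‖c_k u_k − Φ‖² → 0`**
(`tendsto_norm_iff_tendsto_integral_norm_sq`; one-sided forms
`tendsto_integral_norm_sq_renorm_sub_phi_of_limsup_le`, `tendsto_norm_of_tendsto_integral_norm_sq`).
Ingredients: `c_k ⟨u_k, φ_{a_k}⟩ → ‖Φ‖₂²` for bounded constants (`…RenormOverlapLimit`), the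
expansion `∫‖c u − φ_a‖² = ‖c‖² + ‖φ_a‖₂² − 2 Re(c⟨u, φ_a⟩)`, and `φ_a → Φ` in `L²`.  Either side
implies RH (`riemannHypothesis_of_cruxWitness_norm_bounded`, c3): among all witnesses of the
crux, the `L²`-convergent ones (CCM25 §7 in `L²` form) are exactly the minimally renormalised
ones.  No new definitions.
-/

noncomputable section

set_option linter.dupNamespace false

open scoped Topology Real ComplexConjugate FourierTransform
open Filter Set MeasureTheory Complex

namespace Summit.RiemannHypothesis.RiemannHypothesis.Theorems.GroundStatesConvergeToXi

open Literature.NumberTheory.LFunctions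

/-! ## `L²` bookkeeping for `c u − φ_a` and `φ_a → Φ` -/

/-- `φ_a ∈ L²` (a test function). [folklore] -/
theorem memLp_phiCut (a : ℝ) :
    MemLp (fun t : ℝ => (2 : ℂ) * LagariasMontague.Psic (2 * t) *
      ((Literature.Analysis.Calculus.cutoff a t : ℝ) : ℂ)) 2 :=
  (isWeilTest_phiCut a).1.continuous.memLp_of_hasCompactSupport (isWeilTest_phiCut a).2

/-- **Expansion of the `L²` distance to the window kernel**:
`∫‖c u − φ_a‖² = ‖c‖² + ∫‖φ_a‖² − 2 Re(c ∫ u conj φ_a)` for a ground state `u` (`∫‖u‖² = 1`).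
[folklore] -/
theorem integral_norm_sq_renorm_sub_phiCut {a : ℝ} {u : ℝ → ℂ} (hu : IsWeilGroundState a u)
    (c : ℂ) :
    ∫ t, ‖c * u t - (2 : ℂ) * LagariasMontague.Psic (2 * t) *
        ((Literature.Analysis.Calculus.cutoff a t : ℝ) : ℂ)‖ ^ 2 =
      ‖c‖ ^ 2 + (∫ t, ‖(2 : ℂ) * LagariasMontague.Psic (2 * t) *
        ((Literature.Analysis.Calculus.cutoff a t : ℝ) : ℂ)‖ ^ 2) -
      2 * (c * ∫ t, u t * conj ((2 : ℂ) * LagariasMontague.Psic (2 * t) *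
        ((Literature.Analysis.Calculus.cutoff a t : ℝ) : ℂ))).re := by
  set φ : ℝ → ℂ := fun t => (2 : ℂ) * LagariasMontague.Psic (2 * t) *
    ((Literature.Analysis.Calculus.cutoff a t : ℝ) : ℂ) with hφdef
  have hφ2 : MemLp φ 2 := memLp_phiCut a
  have h := ConnesVanSuijlekom.integral_norm_sq_add_mul (f := fun t => -φ t) (h := u) hφ2.neg hu.memLp c
  have e1 : (fun t => ‖-φ t + c * u t‖ ^ 2) = fun t => ‖c * u t - φ t‖ ^ 2 := by
    funext t; rw [neg_add_eq_sub]
  have e2 : (∫ t, ‖-φ t‖ ^ 2) = ∫ t, ‖φ t‖ ^ 2 := by simp only [norm_neg]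
  have e3 : (∫ t, -φ t * conj (u t)) = -conj (∫ t, u t * conj (φ t)) := by
    rw [← integral_conj, ← integral_neg]
    refine integral_congr_ae (ae_of_all _ fun t => ?_)
    simp only [map_mul, Complex.conj_conj]
    ring
  simp only [e1] at h
  rw [h, e2, hu.integral_norm_sq, mul_one, Complex.normSq_eq_norm_sq, e3]
  have e4 : (conj c * -conj (∫ t, u t * conj (φ t))).re = -(c * ∫ t, u t * conj (φ t)).re := by
    rw [mul_neg, Complex.neg_re, ← map_mul, Complex.conj_re]
  rw [e4]
  ring

/-- `∫‖φ_a‖² ≤ ∫‖Φ‖²` (`0 ≤ cutoff ≤ 1`). [folklore] -/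
theorem integral_norm_sq_phiCut_le (a : ℝ) :
    ∫ t, ‖(2 : ℂ) * LagariasMontague.Psic (2 * t) *
        ((Literature.Analysis.Calculus.cutoff a t : ℝ) : ℂ)‖ ^ 2 ≤
      ∫ t : ℝ, ‖(2 : ℂ) * LagariasMontague.Psic (2 * t)‖ ^ 2 := by
  refine integral_mono ((memLp_two_iff_integrable_sq_norm (memLp_phiCut a).1).1 (memLp_phiCut a))
    ((memLp_two_iff_integrable_sq_norm Negative.integrable_phi.aestronglyMeasurable).1 Negative.memLp_phi)
    fun t => ?_
  simp only
  rw [norm_mul, Complex.norm_real, Real.norm_eq_abs,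
    abs_of_nonneg (Literature.Analysis.Calculus.cutoff_nonneg a t), mul_pow]
  exact mul_le_of_le_one_right (sq_nonneg _) (pow_le_one₀
    (Literature.Analysis.Calculus.cutoff_nonneg a t) (Literature.Analysis.Calculus.cutoff_le_one a t))

/-- **`φ_a → Φ` in `L²(ℝ)`**: `∫‖Φ − φ_a‖² → 0` as `a → ∞` (dominated convergence: the integrand
is bounded by `‖Φ‖²` and vanishes for `a ≥ |t| + 1`). [folklore] -/
theorem tendsto_integral_norm_sq_phi_sub_phiCut :
    Tendsto (fun a : ℝ => ∫ t, ‖(2 : ℂ) * LagariasMontague.Psic (2 * t) -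
        (2 : ℂ) * LagariasMontague.Psic (2 * t) * ((Literature.Analysis.Calculus.cutoff a t : ℝ) : ℂ)‖ ^ 2)
      atTop (𝓝 0) := by
  set Φ : ℝ → ℂ := fun t => (2 : ℂ) * LagariasMontague.Psic (2 * t) with hΦdef
  have hΦ2i : Integrable fun t => ‖Φ t‖ ^ 2 :=
    (memLp_two_iff_integrable_sq_norm Negative.integrable_phi.aestronglyMeasurable).1 Negative.memLp_phi
  have h := tendsto_integral_filter_of_dominated_convergence (μ := volume) (l := atTop)
    (F := fun (a : ℝ) (t : ℝ) => ‖Φ t - Φ t * ((Literature.Analysis.Calculus.cutoff a t : ℝ) : ℂ)‖ ^ 2)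
    (f := fun _ => (0 : ℝ)) (fun t => ‖Φ t‖ ^ 2) ?_ ?_ hΦ2i ?_
  · simpa using h
  · refine Eventually.of_forall fun a => ?_
    have hc : Continuous fun t : ℝ => ‖Φ t - Φ t * ((Literature.Analysis.Calculus.cutoff a t : ℝ) : ℂ)‖ ^ 2 :=
      ((continuous_phi.sub (continuous_phi.mul (continuous_ofReal.comp
        (Literature.Analysis.Calculus.contDiff_cutoff a (n := 0)).continuous))).norm.pow 2)
    exact hc.aestronglyMeasurable
  · refine Eventually.of_forall fun a => ae_of_all _ fun t => ?_
    rw [Real.norm_of_nonneg (by positivity)]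
    have e : Φ t - Φ t * ((Literature.Analysis.Calculus.cutoff a t : ℝ) : ℂ) =
        Φ t * (((1 - Literature.Analysis.Calculus.cutoff a t : ℝ)) : ℂ) := by
      push_cast; ring
    rw [e, norm_mul, mul_pow, Complex.norm_real, Real.norm_eq_abs,
      abs_of_nonneg (sub_nonneg.2 (Literature.Analysis.Calculus.cutoff_le_one a t))]
    refine mul_le_of_le_one_right (sq_nonneg _) (pow_le_one₀ (sub_nonneg.2
      (Literature.Analysis.Calculus.cutoff_le_one a t)) ?_)
    linarith [Literature.Analysis.Calculus.cutoff_nonneg a t]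
  · refine ae_of_all _ fun t => ?_
    refine tendsto_const_nhds.congr' ?_
    filter_upwards [eventually_ge_atTop (|t| + 1)] with a ha
    rw [Literature.Analysis.Calculus.cutoff_eq_one (by linarith)]
    simp

/-! ## Minimal renormalisation ⟺ `L²`-convergence -/

/-- **Minimal renormalisation forces `L²`-convergence to Riemann's kernel (RH-free).**  Let
`u_k` be ground states at windows `a_k → ∞` and `c_k` scalars with `c_k û_k → ξ` locally uniformly on
the open strip.  If the constants are asymptotically minimal, `limsup ‖c_k‖² ≤ ∫‖Φ‖²` (in the
`ε`-form below; recall `liminf ‖c_k‖² ≥ ∫‖Φ‖²` always, `…RenormLowerBound`), then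
`∫ ‖c_k u_k − Φ‖² → 0`.  Proof: the constants are bounded, so `c_k⟨u_k, φ_{a_k}⟩ → ‖Φ‖₂²`
(`tendsto_renorm_overlap_of_norm_le`); hence
`∫‖c_k u_k − φ_{a_k}‖² = ‖c_k‖² + ‖φ_{a_k}‖₂² − 2Re(c_k⟨u_k,φ_{a_k}⟩) ≤ ‖c_k‖² − ‖Φ‖₂² + o(1) → 0⁺`,
and `φ_{a_k} → Φ` in `L²`. [folklore] -/
theorem tendsto_integral_norm_sq_renorm_sub_phi_of_limsup_le {a : ℕ → ℝ} {u : ℕ → ℝ → ℂ}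
    {c : ℕ → ℂ} (ha : Tendsto a atTop atTop) (hu : ∀ k, IsWeilGroundState (a k) (u k))
    (hlim : TendstoLocallyUniformlyOn (fun k s => c k * weilMellin (u k) s) riemannXi atTop
      {s : ℂ | 0 < s.re ∧ s.re < 1})
    (hc : ∀ ε : ℝ, 0 < ε → ∀ᶠ k in atTop,
      ‖c k‖ ^ 2 ≤ (∫ t : ℝ, ‖(2 : ℂ) * LagariasMontague.Psic (2 * t)‖ ^ 2) + ε) :
    Tendsto (fun k => ∫ t, ‖c k * u k t - (2 : ℂ) * LagariasMontague.Psic (2 * t)‖ ^ 2)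
      atTop (𝓝 0) := by
  set Φ : ℝ → ℂ := fun t => (2 : ℂ) * LagariasMontague.Psic (2 * t) with hΦdef
  set φ : ℝ → ℝ → ℂ := fun A t => (2 : ℂ) * LagariasMontague.Psic (2 * t) *
    ((Literature.Analysis.Calculus.cutoff A t : ℝ) : ℂ) with hφdef
  set J : ℝ := ∫ t : ℝ, ‖Φ t‖ ^ 2 with hJdef
  have hJ0 : 0 ≤ J := integral_nonneg fun _ => by positivity
  -- the constants are bounded, so the renormalised overlaps converge to `J`
  have hbd : ∃ M : ℝ, ∀ᶠ k in atTop, ‖c k‖ ≤ M := by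
    refine ⟨Real.sqrt (J + 1), ?_⟩
    filter_upwards [hc 1 one_pos] with k hk
    rw [← Real.sqrt_sq (norm_nonneg (c k))]
    exact Real.sqrt_le_sqrt hk
  have hov := tendsto_renorm_overlap_of_norm_le ha hu hlim hbd
  have hovre : Tendsto (fun k => (c k * ∫ t, u k t * conj (φ (a k) t)).re) atTop (𝓝 J) := by
    have h := (Complex.continuous_re.tendsto _).comp hov
    rw [Complex.ofReal_re] at h
    exact h
  -- `A_k := ∫‖c u − φ_a‖² → 0`
  have hA : Tendsto (fun k => ∫ t, ‖c k * u k t - φ (a k) t‖ ^ 2) atTop (𝓝 0) := by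
    rw [Metric.tendsto_nhds]
    intro ε hε
    filter_upwards [hc (ε / 4) (by positivity),
      hovre.eventually (Ioi_mem_nhds (show J - ε / 4 < J by linarith))] with k hck hovk
    have hovk' : J - ε / 4 < (c k * ∫ t, u k t * conj (φ (a k) t)).re := hovk
    have hnn : 0 ≤ ∫ t, ‖c k * u k t - φ (a k) t‖ ^ 2 := integral_nonneg fun _ => by positivity
    rw [dist_zero_right, Real.norm_of_nonneg hnn, integral_norm_sq_renorm_sub_phiCut (hu k) (c k)]
    have h1 := integral_norm_sq_phiCut_le (a k)
    rw [integral_norm_sq_renorm_sub_phiCut (hu k) (c k)] at hnn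
    linarith
  -- `B_k := ∫‖Φ − φ_{a_k}‖² → 0`
  have hB : Tendsto (fun k => ∫ t, ‖Φ t - φ (a k) t‖ ^ 2) atTop (𝓝 0) :=
    tendsto_integral_norm_sq_phi_sub_phiCut.comp ha
  -- `∫‖c u − Φ‖² ≤ 2A_k + 2B_k`
  have hΦ2 : MemLp Φ 2 := Negative.memLp_phi
  refine tendsto_of_tendsto_of_tendsto_of_le_of_le' tendsto_const_nhds
    (by simpa using (hA.const_mul 2).add (hB.const_mul 2))
    (Eventually.of_forall fun k => integral_nonneg fun _ => by positivity)
    (Eventually.of_forall fun k => ?_)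
  have hcu2 : MemLp (fun t => c k * u k t) 2 := (hu k).memLp.const_mul (c k)
  have hφ2 : MemLp (φ (a k)) 2 := memLp_phiCut (a k)
  have hi1 : Integrable fun t => ‖c k * u k t - φ (a k) t‖ ^ 2 :=
    (memLp_two_iff_integrable_sq_norm (hcu2.sub hφ2).1).1 (hcu2.sub hφ2)
  have hi2 : Integrable fun t => ‖Φ t - φ (a k) t‖ ^ 2 :=
    (memLp_two_iff_integrable_sq_norm (hΦ2.sub hφ2).1).1 (hΦ2.sub hφ2)
  have hi3 : Integrable fun t => ‖c k * u k t - Φ t‖ ^ 2 :=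
    (memLp_two_iff_integrable_sq_norm (hcu2.sub hΦ2).1).1 (hcu2.sub hΦ2)
  calc ∫ t, ‖c k * u k t - Φ t‖ ^ 2
      ≤ ∫ t, (2 * ‖c k * u k t - φ (a k) t‖ ^ 2 + 2 * ‖Φ t - φ (a k) t‖ ^ 2) := by
        refine integral_mono hi3 ((hi1.const_mul 2).add (hi2.const_mul 2)) fun t => ?_
        have e : c k * u k t - Φ t = (c k * u k t - φ (a k) t) - (Φ t - φ (a k) t) := by ring
        simp only
        rw [e]
        have h1 := norm_sub_le (c k * u k t - φ (a k) t) (Φ t - φ (a k) t)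
        have h2 : ‖c k * u k t - φ (a k) t - (Φ t - φ (a k) t)‖ ^ 2 ≤
            (‖c k * u k t - φ (a k) t‖ + ‖Φ t - φ (a k) t‖) ^ 2 :=
          pow_le_pow_left₀ (norm_nonneg _) h1 2
        nlinarith [sq_nonneg (‖c k * u k t - φ (a k) t‖ - ‖Φ t - φ (a k) t‖)]
    _ = 2 * (∫ t, ‖c k * u k t - φ (a k) t‖ ^ 2) + 2 * ∫ t, ‖Φ t - φ (a k) t‖ ^ 2 := by
        rw [integral_add (hi1.const_mul 2) (hi2.const_mul 2), integral_const_mul, integral_const_mul]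

/-- **Conversely, `L²`-convergence forces minimal renormalisation**: `∫‖c_k u_k − Φ‖² → 0` for
normalised `u_k` (`∫‖u_k‖² = 1`) gives `‖c_k‖ → ‖Φ‖₂` (reverse Minkowski). [folklore] -/
theorem tendsto_norm_of_tendsto_integral_norm_sq {a : ℕ → ℝ} {u : ℕ → ℝ → ℂ} {c : ℕ → ℂ}
    (hu : ∀ k, IsWeilGroundState (a k) (u k))
    (hL2 : Tendsto (fun k => ∫ t, ‖c k * u k t - (2 : ℂ) * LagariasMontague.Psic (2 * t)‖ ^ 2)
      atTop (𝓝 0)) :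
    Tendsto (fun k => ‖c k‖) atTop
      (𝓝 (Real.sqrt (∫ t : ℝ, ‖(2 : ℂ) * LagariasMontague.Psic (2 * t)‖ ^ 2))) := by
  set Φ : ℝ → ℂ := fun t => (2 : ℂ) * LagariasMontague.Psic (2 * t) with hΦdef
  set J : ℝ := ∫ t : ℝ, ‖Φ t‖ ^ 2 with hJdef
  have hΦ2 : MemLp Φ 2 := Negative.memLp_phi
  have hsqrt : Tendsto (fun k => Real.sqrt (∫ t, ‖c k * u k t - Φ t‖ ^ 2)) atTop (𝓝 0) := by
    simpa using hL2.sqrt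
  rw [Metric.tendsto_nhds]
  intro ε hε
  filter_upwards [hsqrt.eventually (Iio_mem_nhds hε)] with k hk
  have hk' : Real.sqrt (∫ t, ‖c k * u k t - Φ t‖ ^ 2) < ε := hk
  have hcu2 : MemLp (fun t => c k * u k t) 2 := (hu k).memLp.const_mul (c k)
  have e2 : Real.sqrt (∫ t, ‖c k * u k t‖ ^ 2) = ‖c k‖ := by
    simp only [norm_mul, mul_pow]
    rw [integral_const_mul, (hu k).integral_norm_sq, mul_one, Real.sqrt_sq (norm_nonneg _)]
  -- `‖c‖ ≤ √(∫‖cu − Φ‖²) + √J` and `√J ≤ √(∫‖cu − Φ‖²) + ‖c‖`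
  have h1 := sqrt_integral_norm_sq_sub_le (f := fun t => c k * u k t - Φ t) (h := fun t => -Φ t)
    (hcu2.sub hΦ2) hΦ2.neg
  simp only [sub_neg_eq_add, sub_add_cancel, norm_neg] at h1
  rw [e2] at h1
  have h2 := sqrt_integral_norm_sq_sub_le (f := fun t => Φ t - c k * u k t) (h := fun t => -(c k * u k t))
    (hΦ2.sub hcu2) hcu2.neg
  simp only [sub_neg_eq_add, sub_add_cancel, norm_neg] at h2
  rw [e2] at h2
  have e3 : (∫ t, ‖Φ t - c k * u k t‖ ^ 2) = ∫ t, ‖c k * u k t - Φ t‖ ^ 2 := by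
    refine integral_congr_ae (ae_of_all _ fun t => ?_)
    simp only [norm_sub_rev]
  rw [e3] at h2
  rw [dist_eq_norm, Real.norm_eq_abs, abs_lt]
  constructor <;> linarith

/-- **Minimal renormalisation ⟺ `L²`-convergence, for every witness of the crux's convergence
clause (RH-free).**  For ground states `u_k` at `a_k → ∞` and `c_k` with `c_k û_k → ξ` locally
uniformly on the open strip: `‖c_k‖ → ‖Φ‖₂` iff `∫‖c_k u_k − Φ‖² → 0`.  Both sides imply RH
(`riemannHypothesis_of_cruxWitness_norm_bounded`); the `L²`-convergent witnesses (CCM25 §7 in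
`L²` form) are exactly the minimally renormalised ones. [folklore] -/
theorem tendsto_norm_iff_tendsto_integral_norm_sq {a : ℕ → ℝ} {u : ℕ → ℝ → ℂ} {c : ℕ → ℂ}
    (ha : Tendsto a atTop atTop) (hu : ∀ k, IsWeilGroundState (a k) (u k))
    (hlim : TendstoLocallyUniformlyOn (fun k s => c k * weilMellin (u k) s) riemannXi atTop
      {s : ℂ | 0 < s.re ∧ s.re < 1}) :
    Tendsto (fun k => ‖c k‖) atTop
        (𝓝 (Real.sqrt (∫ t : ℝ, ‖(2 : ℂ) * LagariasMontague.Psic (2 * t)‖ ^ 2))) ↔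
      Tendsto (fun k => ∫ t, ‖c k * u k t - (2 : ℂ) * LagariasMontague.Psic (2 * t)‖ ^ 2)
        atTop (𝓝 0) := by
  refine ⟨fun h => tendsto_integral_norm_sq_renorm_sub_phi_of_limsup_le ha hu hlim fun ε hε => ?_,
    tendsto_norm_of_tendsto_integral_norm_sq hu⟩
  set J : ℝ := ∫ t : ℝ, ‖(2 : ℂ) * LagariasMontague.Psic (2 * t)‖ ^ 2 with hJdef
  have hJ0 : 0 ≤ J := integral_nonneg fun _ => by positivity
  have h2 : Tendsto (fun k => ‖c k‖ ^ 2) atTop (𝓝 J) := by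
    have := h.pow 2
    rwa [Real.sq_sqrt hJ0] at this
  filter_upwards [h2.eventually (Iio_mem_nhds (show J < J + ε by linarith))] with k hk
  exact le_of_lt hk

/-- **A minimally renormalised witness of the crux proves RH** (its constants are bounded;
`riemannHypothesis_of_cruxWitness_norm_bounded`, c3) — recorded next to the equivalence for
completeness. [folklore] -/
theorem riemannHypothesis_of_cruxWitness_tendsto_norm {a : ℕ → ℝ} {u : ℕ → ℝ → ℂ} {c : ℕ → ℂ}
    (ha : Tendsto a atTop atTop) (hu : ∀ k, IsWeilGroundState (a k) (u k))
    (hlim : TendstoLocallyUniformlyOn (fun k s => c k * weilMellin (u k) s) riemannXi atTop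
      {s : ℂ | 0 < s.re ∧ s.re < 1})
    (h : Tendsto (fun k => ‖c k‖) atTop
      (𝓝 (Real.sqrt (∫ t : ℝ, ‖(2 : ℂ) * LagariasMontague.Psic (2 * t)‖ ^ 2)))) :
    RiemannHypothesis := by
  obtain ⟨M, hM⟩ := h.bddAbove_range
  exact riemannHypothesis_of_cruxWitness_norm_bounded ha hu hlim ⟨M, fun k => hM ⟨k, rfl⟩⟩

end Summit.RiemannHypothesis.RiemannHypothesis.Theorems.GroundStatesConvergeToXi

end
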